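import Summits.ValiantsHypothesis.ValiantsHypothesis.Theorems.GrenetZeonDualUnipotentThreeHalvesHeavyTopTorusInitial

/-!
# `GrenetZeon.DualUnipotentThreeHalves` (stmt-ValiantsHypothesis-24318), R2 heavy-top instrument — P-Q1 top-level glue:
# CONJUGATION TRANSPORT of a nilpotent space (`V ↦ P⁻¹ V P`) and of (ir)reducibility

Experiment cell «val-heavytop-census» (D-0160), engine seat val-htc-eng-2 g3 (kernel-only lane; P-Q1 port, eng lineage).  The Q1 theorem
(«a codimension-one nilpotent subspace of `M_{s+1}(ℂ)` of generic type `(s,1)` is reducible») is assembled from eng-1 g3's Jordan normal form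
✓ `HeavyTopJordanShift.exists_isUnit_conj_eq_shift` (`P⁻¹ Z₀ P = A = J_s ⊕ 0`), ✓ `HeavyTopLevelOneSubspace.level_one_of_subspace` /
✓ `HeavyTopLevelTwoLifts.lifts` (this seat) and eng-1 g3's ✓ `HeavyTopLevelTwoFinal` (L2.8).  THIS FILE supplies the two generic transport facts:

* `exists_conj_subspace` — for `P` invertible and `V ≤ M_n(ℂ)`: the conjugate space `V' = {P⁻¹ Z P}` as a `Submodule` with `finrank V' = finrank V`,
  membership both ways, and `Z^p = 0` on `V` ⇒ `Z'^p = 0` on `V'`;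
* `not_irreducible_of_conj` — if `V'` has a non-trivial proper invariant subspace then so has `V` (transport by `x ↦ P x`).

Honest framing: glue for the instrument's kernel port P-Q1; nothing here proves or refutes `HeavyTopLaw`/`HeavyTopSlowLaw`, 24318, S3 or 8062;
`VP ≠ VNP` is NOT proved.  No definitions.  [folklore; this seat]
-/

noncomputable section

-- single-conjunct layout: Sub = Summit, duplicated namespace component intended
set_option linter.dupNamespace false

namespace Summit.ValiantsHypothesis.ValiantsHypothesis.Theorems.GrenetZeon.HeavyTopConjTransport

open Matrix
open Summit.ValiantsHypothesis.ValiantsHypothesis.Theorems.GrenetZeon.HeavyTopTorusInitial (conj_pow_eq)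

/-- **The conjugate space.**  For `P` invertible: `V' := P⁻¹ V P` is a linear space of the same dimension; `Z ∈ V ↔ P⁻¹ Z P ∈ V'`,
`Z' ∈ V' ↔ P Z' P⁻¹ ∈ V`; and `Z^p = 0` on `V` gives `Z'^p = 0` on `V'`. [folklore] -/
theorem exists_conj_subspace {n : Type*} [Fintype n] [DecidableEq n] (P : Matrix n n ℂ) (hP : IsUnit P)
    (V : Submodule ℂ (Matrix n n ℂ)) :
    ∃ V' : Submodule ℂ (Matrix n n ℂ), Module.finrank ℂ V' = Module.finrank ℂ V ∧
      (∀ Z, Z ∈ V → P⁻¹ * Z * P ∈ V') ∧ (∀ Z', Z' ∈ V' → P * Z' * P⁻¹ ∈ V) ∧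
      (∀ Z', Z' ∈ V' ↔ P * Z' * P⁻¹ ∈ V) ∧
      ∀ p : ℕ, (∀ Z ∈ V, Z ^ p = 0) → ∀ Z' ∈ V', Z' ^ p = 0 := by
  classical
  have hPdet : IsUnit P.det := (Matrix.isUnit_iff_isUnit_det P).1 hP
  have h1 : P⁻¹ * P = 1 := Matrix.nonsing_inv_mul P hPdet
  have h2 : P * P⁻¹ = 1 := Matrix.mul_nonsing_inv P hPdet
  -- conjugation as a linear equivalence `X ↦ P⁻¹ X P`
  let e : Matrix n n ℂ ≃ₗ[ℂ] Matrix n n ℂ :=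
    { toFun := fun X => P⁻¹ * X * P
      invFun := fun Y => P * Y * P⁻¹
      map_add' := fun X Y => by rw [Matrix.mul_add, Matrix.add_mul]
      map_smul' := fun c X => by rw [Matrix.mul_smul, Matrix.smul_mul, RingHom.id_apply]
      left_inv := fun X => by
        show P * (P⁻¹ * X * P) * P⁻¹ = X
        calc P * (P⁻¹ * X * P) * P⁻¹ = (P * P⁻¹) * X * (P * P⁻¹) := by simp only [Matrix.mul_assoc]
          _ = X := by rw [h2, Matrix.one_mul, Matrix.mul_one]
      right_inv := fun Y => by
        show P⁻¹ * (P * Y * P⁻¹) * P = Y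
        calc P⁻¹ * (P * Y * P⁻¹) * P = (P⁻¹ * P) * Y * (P⁻¹ * P) := by simp only [Matrix.mul_assoc]
          _ = Y := by rw [h1, Matrix.one_mul, Matrix.mul_one] }
  have he : ∀ X, e X = P⁻¹ * X * P := fun X => rfl
  have hes : ∀ Y, e.symm Y = P * Y * P⁻¹ := fun Y => rfl
  refine ⟨V.map (e : Matrix n n ℂ →ₗ[ℂ] Matrix n n ℂ), LinearEquiv.finrank_map_eq e V, fun Z hZ => ?_, fun Z' hZ' => ?_, fun Z' => ?_,
    fun p hV => ?_⟩
  · exact ⟨Z, hZ, rfl⟩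
  · obtain ⟨Z, hZ, rfl⟩ := hZ'
    have : P * e Z * P⁻¹ = Z := by rw [← hes, LinearEquiv.symm_apply_apply]
    rw [show ((e : Matrix n n ℂ →ₗ[ℂ] Matrix n n ℂ) Z) = e Z from rfl, this]; exact hZ
  · constructor
    · rintro ⟨Z, hZ, rfl⟩
      have : P * e Z * P⁻¹ = Z := by rw [← hes, LinearEquiv.symm_apply_apply]
      rw [show ((e : Matrix n n ℂ →ₗ[ℂ] Matrix n n ℂ) Z) = e Z from rfl, this]; exact hZ
    · intro h
      refine ⟨P * Z' * P⁻¹, h, ?_⟩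
      show e (P * Z' * P⁻¹) = Z'
      rw [← hes, LinearEquiv.apply_symm_apply]
  · rintro Z' ⟨Z, hZ, rfl⟩
    show (e Z) ^ p = 0
    rw [he, conj_pow_eq P⁻¹ P Z h2 h1 p, hV Z hZ, Matrix.mul_zero, Matrix.zero_mul]

/-- **Transport of reducibility.**  If every `P⁻¹ Z P` (`Z ∈ V`) lies in a space `V'` that has a non-trivial proper invariant subspace, then
`V` has one too (namely its image under `x ↦ P x`). [folklore] -/
theorem not_irreducible_of_conj {m : ℕ} (P : Matrix (Fin m) (Fin m) ℂ) (hP : IsUnit P)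
    (V V' : Submodule ℂ (Matrix (Fin m) (Fin m) ℂ)) (hVV' : ∀ Z ∈ V, P⁻¹ * Z * P ∈ V')
    (h : ¬ ∀ U : Submodule ℂ (Fin m → ℂ), (∀ A ∈ V', ∀ x ∈ U, A *ᵥ x ∈ U) → U = ⊥ ∨ U = ⊤) :
    ¬ ∀ U : Submodule ℂ (Fin m → ℂ), (∀ A ∈ V, ∀ x ∈ U, A *ᵥ x ∈ U) → U = ⊥ ∨ U = ⊤ := by
  classical
  intro hirr
  apply h
  intro U' hU'
  have hPdet : IsUnit P.det := (Matrix.isUnit_iff_isUnit_det P).1 hP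
  have h1 : P⁻¹ * P = 1 := Matrix.nonsing_inv_mul P hPdet
  have h2 : P * P⁻¹ = 1 := Matrix.mul_nonsing_inv P hPdet
  -- `U := P U'`
  set U : Submodule ℂ (Fin m → ℂ) := U'.map (Matrix.toLin' P) with hU
  have hUinv : ∀ A ∈ V, ∀ x ∈ U, A *ᵥ x ∈ U := by
    rintro A hA x ⟨u, hu, rfl⟩
    refine ⟨(P⁻¹ * A * P) *ᵥ u, hU' _ (hVV' A hA) u hu, ?_⟩
    simp only [Matrix.toLin'_apply]
    rw [Matrix.mulVec_mulVec, ← Matrix.mul_assoc, ← Matrix.mul_assoc, h2, Matrix.one_mul, Matrix.mulVec_mulVec]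
  rcases hirr U hUinv with hbot | htop
  · left
    rw [eq_bot_iff]
    intro u hu
    have hPu : P *ᵥ u ∈ U := ⟨u, hu, rfl⟩
    rw [hbot, Submodule.mem_bot] at hPu
    rw [Submodule.mem_bot]
    have := congrArg (fun y => P⁻¹ *ᵥ y) hPu
    simpa [Matrix.mulVec_mulVec, h1] using this
  · right
    rw [eq_top_iff]
    intro x _
    have hx : P *ᵥ x ∈ U := by rw [htop]; exact Submodule.mem_top
    obtain ⟨u, hu, hPu⟩ := hx
    simp only [Matrix.toLin'_apply] at hPu
    have hux : u = x := by
      have := congrArg (fun y => P⁻¹ *ᵥ y) hPu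
      simpa [Matrix.mulVec_mulVec, h1] using this
    rw [← hux]; exact hu

end Summit.ValiantsHypothesis.ValiantsHypothesis.Theorems.GrenetZeon.HeavyTopConjTransport

end
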